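import Summits.BirchSwinnertonDyer.BirchSwinnertonDyer.Theorems.ByReductionTypeAtTwoGoodOrdTowerHensel
import Literature.NumberTheory.EllipticCurves.LFunctionPrimeCoeff
import HarnessLib

/-!
# Route `ByReductionTypeAtTwo` (K4), TOWER road — the reductions of `E(K_{∞,η})` at a good `v ∣ p` are EXACTLY `Ẽ(𝔽_p)`:
# `#red₀(E(K̄_v)^{H_∞}) = #Ẽ(𝔽_p) = reductionPointCount W p`

Cell `bsd-2adic`, seat `bsd-2adic-tower-1` (GEN 25), `--supports stmt-BirchSwinnertonDyer-19271` (helper). TOOL theorem only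
(no definition, no named fact, no `sorry`); closes nothing by itself; BSD is not proved by any of this. Part (d) of the
programme «Greenberg LNM 1716 Lemma 3.4 at layer `0` EXACT ⇒ Thm. 4.1 over `ℚ` ⇒ the `hEC` binder of the TOWER doors in the
kernel» (siblings `…EulerCharLayerZero/CoinvExact/CoinvInput/Devissage.lean`).

In the dévissage `0 → M₁/(g−1)M₁ → M/(g−1)M → red₀(M) → 0` (`M = E(K̄_v)^{H_∞}`, sibling `…EulerCharDevissage.lean`) the last
term is the group of reductions of the points of `E` over the local cyclotomic tower. Since that tower is TOTALLY RAMIFIED at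
`p` over `ℚ`, an arithmetic Frobenius `τ` lies in `H_∞` (`resGal_mem_kerSubgroup_of_forall_smul_rootOfUnity_eq`), so every
reduction `red₀ Q`, `Q ∈ M`, is fixed by Frobenius: its coordinates in `k̄` satisfy `x̄^p = x̄`
(`residueMap_pow_eq_of_reducePoint_smul_eq`), i.e. come from `𝔽_v` — and conversely every `𝔽_v`-point of the good reduction
`W_ℤ ⊗ 𝔽_v` lifts to `E(ℚ_v) ⊆ M` by Hensel (`WeierstrassCurve.exists_equation_residue_eq`), exactly as in this lineage's GEN 11
`GoodOrdTower.exists_fixed_localRed_eq`. Comparing coordinates in `k̄_v` (the residue map `r` of `exists_residueMap`):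

* **`finite_range_localRed_fixedPoints_and_natCard_eq`** — for `W/ℚ` globally minimal and elliptic with `p ∤ Δ_W`, `v ∋ p`,
  the spectral valuation `w`, the reduction `red₀` of the good model `W_ℤ ⊗ 𝒪_w`, any `ℤ_p`-extension `κ` of `ℚ` and any
  arithmetic Frobenius `τ ∈ H_∞ = localSubgroup (ker κ) ℚ_v`: `red₀(E(K̄_v)^{H_∞})` is finite of order
  `reductionPointCount W p = #Ẽ(𝔽_p)`.

References: [GreenbergLNM1716] §2 p. 70, §3 Lemma 3.4 (p. 89); [SilvermanAEC2009] VII.2 Prop. 2.1.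
-/

set_option autoImplicit false
-- the Theorems namespace of this sub repeats the summit name by design (D-0017 nested layout: Summit.<S>.<Sub>)
set_option linter.dupNamespace false

noncomputable section

open scoped Classical NNReal ValuativeRel

universe u

namespace Summit.BirchSwinnertonDyer.BirchSwinnertonDyer.Theorems.GoodOrdTower

open NumberField IsDedekindDomain Field Polynomial Literature.NumberTheory.EllipticCurves
  Literature.NumberTheory.GaloisRepresentations IsDedekindDomain.HeightOneSpectrum
  Literature.NumberTheory.EllipticCurves.FormalGroupChart WeierstrassCurve Rat.HeightOneSpectrum

variable {p : ℕ} [hp : Fact p.Prime] {κ : ZpExtension ℚ p}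

variable (W : WeierstrassCurve ℚ) [W.IsGloballyMinimal] {v : HeightOneSpectrum (𝓞 ℚ)}
  {w : Valuation (AlgebraicClosure (v.adicCompletion ℚ)) ℝ≥0}
  (hw : ∀ x, (w x : ℝ) = spectralNorm (v.adicCompletion ℚ) (AlgebraicClosure (v.adicCompletion ℚ)) x)
  (hΔu : IsUnit ((integralModelInt W).map (algebraMap ℤ ↥w.valuationSubring)).Δ)
  (red₀ : localPoints W (v.adicCompletion ℚ) →+
    (((integralModelInt W).map (algebraMap ℤ ↥w.valuationSubring)).map
      (IsLocalRing.residue ↥w.valuationSubring)).toAffine.Point)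
  (hred₀ : ∀ P : localPoints W (v.adicCompletion ℚ), red₀ P =
    ((integralModelInt W).map (algebraMap ℤ ↥w.valuationSubring)).reducePoint
      (Affine.Point.congrEquiv (localIntModel_baseChange W w.valuationSubring).symm P))

variable [W.IsElliptic]

omit [W.IsElliptic] in
/-- The `𝔽_v`-points of the reduction `W_ℤ ⊗ 𝔽_v` of a globally minimal `W/ℚ` at `v ∋ p` number `reductionPointCount W p`
(`𝔽_v ≃ ℤ/p` along `padicIntEquiv`; as in `natCard_point_reduction_minimal_baseChange`). [cite: SilvermanAEC2009, Prop. VII.1.3(b)] -/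
private theorem natCard_point_integralModelInt_residue (hpv : (p : 𝓞 ℚ) ∈ v.asIdeal) :
    Nat.card (((integralModelInt W).map (algebraMap ℤ (v.adicCompletionIntegers ℚ))).map
      (IsLocalRing.residue (v.adicCompletionIntegers ℚ))).toAffine.Point = W.reductionPointCount p := by
  have hvp : (primesEquiv v : ℕ) = p := primesEquiv_eq_of_natCast_mem v hp.out hpv
  haveI := Fact.mk (primesEquiv v).2
  have h : Nat.card (((integralModelInt W).map (algebraMap ℤ (v.adicCompletionIntegers ℚ))).map
      (IsLocalRing.residue (v.adicCompletionIntegers ℚ))).toAffine.Point =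
      W.reductionPointCount (primesEquiv v : ℕ) := by
    rw [WeierstrassCurve.map_map, ← natCard_point_map_ringEquiv ((IsLocalRing.ResidueField.mapEquiv
      (adicCompletionIntegers.padicIntEquiv v).toAlgEquiv.toRingEquiv).trans
      (PadicInt.residueField (p := (primesEquiv v : ℕ)))), WeierstrassCurve.map_map, reductionPointCount]
    exact congrArg (fun f : ℤ →+* ZMod (primesEquiv v : ℕ) ↦
      Nat.card ((integralModelInt W).map f).toAffine.Point) (RingHom.ext_int _ _)
  rwa [hvp] at h

include hw hΔu hred₀ in
set_option maxHeartbeats 3200000 in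
/-- **The reductions of `E(K̄_v)^{H_∞}` are exactly `Ẽ(𝔽_p)`: `#red₀(E(K̄_v)^{H_∞}) = reductionPointCount W p`.** For `W/ℚ`
globally minimal and elliptic with `p ∤ Δ_W`, `v ∋ p`, the reduction `red₀` of the good model `W_ℤ ⊗ 𝒪_w`, a `ℤ_p`-extension `κ`
of `ℚ` and an arithmetic Frobenius `τ` at `𝔐` lying in `H_∞ = localSubgroup (ker κ) ℚ_v`: the image of the `H_∞`-fixed points
under `red₀` is finite of order `reductionPointCount W p`. (`⊆`: a point fixed by `τ` has reduction with coordinates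
`x̄^p = x̄`, hence an `𝔽_v`-point of `W_ℤ ⊗ 𝔽_v`; `⊇`: Hensel lifts `𝔽_v`-points to `E(ℚ_v) ⊆ E(K̄_v)^{H_∞}`; the two sides
are compared through their coordinates in `k̄_v`.) [cite: SilvermanAEC2009, VII.2 Prop. 2.1 (PDF p. 167)]
[cite: GreenbergLNM1716, §2 p. 70 and §3 Lemma 3.4 (p. 89)] -/
theorem finite_range_localRed_fixedPoints_and_natCard_eq (hpv : (p : 𝓞 ℚ) ∈ v.asIdeal)
    (hΔ : ¬ (p : ℤ) ∣ minimalDiscriminantInt W)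
    {𝔐 : Ideal v.localAbsIntegers} (h𝔐 : 𝔐 ∈ v.localPrimesAbove)
    {τ : absoluteGaloisGroup (v.adicCompletion ℚ)} (hτ : IsArithFrobAt (v.adicCompletionIntegers ℚ) τ 𝔐)
    (hτHi : τ ∈ localSubgroup κ.kerSubgroup (v.adicCompletion ℚ)) :
    Finite (red₀.comp (FixedPoints.addSubgroup (localSubgroup κ.kerSubgroup (v.adicCompletion ℚ))
      (localPoints W (v.adicCompletion ℚ))).subtype).range ∧
    Nat.card (red₀.comp (FixedPoints.addSubgroup (localSubgroup κ.kerSubgroup (v.adicCompletion ℚ))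
      (localPoints W (v.adicCompletion ℚ))).subtype).range = W.reductionPointCount p := by
  -- notation
  let K := v.adicCompletion ℚ
  let O := v.adicCompletionIntegers ℚ
  let F := IsLocalRing.ResidueField O
  let kbar := AlgebraicClosure F
  let L := AlgebraicClosure K
  let Pt : Type := localPoints W K
  let Hi : Subgroup (absoluteGaloisGroup K) := localSubgroup κ.kerSubgroup K
  let M : AddSubgroup Pt := FixedPoints.addSubgroup Hi Pt
  let R := (red₀.comp M.subtype).range
  have hvO : w.Integers w.valuationSubring := Valuation.valuationSubring.integers w
  haveI hV : (W.baseChange L).IsIntegral w.integer :=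
    ⟨⟨(integralModelInt W).map (algebraMap ℤ ↥w.integer), W.baseChange_eq_localIntModel_integer_baseChange⟩⟩
  obtain ⟨r, hr, hrc, hrF⟩ := exists_residueMap (v := v) hw h𝔐
  haveI : Finite F := finite_residueField_adicCompletionIntegers ℚ v
  -- `r` factors through the residue field of `𝒪_w`, injectively
  have hker : ∀ a ∈ IsLocalRing.maximalIdeal ↥w.valuationSubring, r a = 0 := by
    intro a ha
    rw [IsLocalRing.mem_maximalIdeal, mem_nonunits_iff, hvO.isUnit_iff_valuation_eq_one] at ha
    exact (hr a).mpr (lt_of_le_of_ne ((Valuation.mem_valuationSubring_iff w _).mp a.2) ha)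
  let rt : IsLocalRing.ResidueField ↥w.valuationSubring →+* kbar :=
    Ideal.Quotient.lift (IsLocalRing.maximalIdeal ↥w.valuationSubring) r hker
  have hrt : ∀ a, rt (IsLocalRing.residue ↥w.valuationSubring a) = r a := fun a ↦ Ideal.Quotient.lift_mk _ _ _
  have hrt_inj : Function.Injective rt := RingHom.injective _
  -- elements of `k̄` with `c^q = c` come from `𝔽_v`
  have hroots : ∀ c : kbar, c ^ Nat.card F = c → ∃ c₀ : F, algebraMap F kbar c₀ = c := by
    intro c hc
    set q := Nat.card F with hq
    haveI : Fintype F := Fintype.ofFinite _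
    have hq1 : 1 < q := by rw [hq]; exact Finite.one_lt_card
    let f : Polynomial kbar := X ^ q - X
    have hf0 : f ≠ 0 := FiniteField.X_pow_card_sub_X_ne_zero _ hq1
    have hdeg : f.natDegree = q := FiniteField.X_pow_card_sub_X_natDegree_eq _ hq1
    let S : Finset kbar := Finset.univ.image (algebraMap F kbar)
    have hScard : S.card = q := by
      simp only [S]
      rw [Finset.card_image_of_injective _ (algebraMap F kbar).injective, Finset.card_univ, hq, Nat.card_eq_fintype_card]
    have hSroots : S ⊆ f.roots.toFinset := by
      intro a ha
      obtain ⟨a₀, -, rfl⟩ := Finset.mem_image.mp ha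
      rw [Multiset.mem_toFinset, Polynomial.mem_roots hf0, Polynomial.IsRoot, eval_sub, eval_pow, eval_X,
        ← map_pow, hq, ← Fintype.card_eq_nat_card, FiniteField.pow_card, sub_self]
    have hcroot : c ∈ f.roots.toFinset := by
      rw [Multiset.mem_toFinset, Polynomial.mem_roots hf0, Polynomial.IsRoot, eval_sub, eval_pow, eval_X, hc, sub_self]
    have hle : f.roots.toFinset.card ≤ q :=
      (Multiset.toFinset_card_le _).trans ((Polynomial.card_roots' f).trans hdeg.le)
    have hSeq : S = f.roots.toFinset := Finset.eq_of_subset_of_card_le hSroots (by rw [hScard]; exact hle)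
    rw [← hSeq] at hcroot
    obtain ⟨c₀, -, hc₀⟩ := Finset.mem_image.mp hcroot
    exact ⟨c₀, hc₀⟩
  -- the reduction `Ẽ₀ = W_ℤ ⊗ 𝔽_v` is elliptic (`p ∤ Δ`)
  have hϖ : Irreducible ((p : ℕ) : O) := irreducible_natCast_adicCompletionIntegers_rat hpv
  haveI hchark : CharP F p := by
    refine (CharP.charP_iff_prime_eq_zero hp.out).mpr ?_
    rw [← map_natCast (IsLocalRing.residue O), IsLocalRing.residue_eq_zero_iff]
    exact hϖ.not_isUnit
  haveI hE₀ : ((((integralModelInt W).map (algebraMap ℤ O)).map (IsLocalRing.residue O))).IsElliptic := by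
    refine ⟨?_⟩
    rw [map_Δ, map_Δ, eq_intCast, map_intCast, isUnit_iff_ne_zero, ne_eq, CharP.intCast_eq_zero_iff _ p]
    exact hΔ
  haveI : Finite (((integralModelInt W).map (algebraMap ℤ O)).map (IsLocalRing.residue O)).toAffine.Point :=
    WeierstrassCurve.finite_point _
  have hZk : (r.comp (algebraMap ℤ ↥w.valuationSubring)) =
      ((algebraMap F kbar).comp (IsLocalRing.residue O)).comp (algebraMap ℤ O) := RingHom.ext_int _ _
  -- coordinate signatures in `k̄ × k̄`
  let σB : (((integralModelInt W).map (algebraMap ℤ ↥w.valuationSubring)).map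
      (IsLocalRing.residue ↥w.valuationSubring)).toAffine.Point → Option (kbar × kbar) := fun Q ↦
    match Q with
    | .zero => none
    | .some x y _ => some (rt x, rt y)
  let σF : (((integralModelInt W).map (algebraMap ℤ O)).map (IsLocalRing.residue O)).toAffine.Point →
      Option (kbar × kbar) := fun Q ↦
    match Q with
    | .zero => none
    | .some x y _ => some (algebraMap F kbar x, algebraMap F kbar y)
  have hσB : Function.Injective σB := by
    rintro (_ | ⟨x, y, h⟩) (_ | ⟨x', y', h'⟩) he
    · rfl
    · exact absurd he (by simp [σB])
    · exact absurd he (by simp [σB])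
    · simp only [σB, Option.some.injEq, Prod.mk.injEq] at he
      obtain ⟨hx, hy⟩ := he
      cases hrt_inj hx; cases hrt_inj hy; rfl
  have hσF : Function.Injective σF := by
    rintro (_ | ⟨x, y, h⟩) (_ | ⟨x', y', h'⟩) he
    · rfl
    · exact absurd he (by simp [σF])
    · exact absurd he (by simp [σF])
    · simp only [σF, Option.some.injEq, Prod.mk.injEq] at he
      obtain ⟨hx, hy⟩ := he
      cases (algebraMap F kbar).injective hx; cases (algebraMap F kbar).injective hy; rfl
  -- (⊆) every reduction of an `H_∞`-fixed point has the signature of an `𝔽_v`-point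
  have hsub : ∀ b : R, ∃ Q, σF Q = σB (b : _) := by
    rintro ⟨b, ⟨P, rfl⟩⟩
    have hPfix : τ • (P : Pt) = P := (FixedPoints.mem_addSubgroup _ _ _).mp P.2 ⟨τ, hτHi⟩
    change ∃ Q, σF Q = σB (red₀ (P : Pt))
    rcases hP : ((P : Pt) : (W.baseChange L).toAffine.Point) with _ | ⟨x, y, h⟩
    · refine ⟨0, ?_⟩
      change σF 0 = σB (red₀ (0 : Pt))
      rw [map_zero]
    by_cases hx : w x ≤ 1
    swap
    · refine ⟨0, ?_⟩
      rw [(W.localRed_eq_zero_iff_mem_kernel hΔu red₀ hred₀ _).mpr (some_mem_kernel h (not_le.mp hx))]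
    have hPxy : (P : Pt) = Affine.Point.some x y h := hP
    have heq : ((integralModelInt W).map (algebraMap ℤ ↥w.valuationSubring)).reducePoint
        (Affine.Point.congrEquiv (localIntModel_baseChange W w.valuationSubring).symm (τ • (P : Pt))) =
        ((integralModelInt W).map (algebraMap ℤ ↥w.valuationSubring)).reducePoint
        (Affine.Point.congrEquiv (localIntModel_baseChange W w.valuationSubring).symm (P : Pt)) := by
      rw [← hred₀, ← hred₀, hPfix]
    obtain ⟨hy, hxq, hyq⟩ := residueMap_pow_eq_of_reducePoint_smul_eq hw hr hrF hτ hΔu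
      (localIntModel_baseChange W w.valuationSubring) hx hPxy heq
    obtain ⟨c₀, hc₀⟩ := hroots _ hxq
    obtain ⟨d₀, hd₀⟩ := hroots _ hyq
    have hMns : (((integralModelInt W).map (algebraMap ℤ ↥w.valuationSubring)).baseChange L).toAffine.Nonsingular x y := by
      rw [localIntModel_baseChange W w.valuationSubring]; exact h
    have heqO : ((integralModelInt W).map (algebraMap ℤ ↥w.valuationSubring)).toAffine.Equation ⟨x, hx⟩ ⟨y, hy⟩ :=
      (map_equation_iff hvO.hom_inj).mp hMns.1
    have heqkbar : ((((integralModelInt W).map (algebraMap ℤ O)).map (IsLocalRing.residue O)).map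
        (algebraMap F kbar)).toAffine.Equation (algebraMap F kbar c₀) (algebraMap F kbar d₀) := by
      rw [hc₀, hd₀, WeierstrassCurve.map_map, WeierstrassCurve.map_map, ← hZk, ← WeierstrassCurve.map_map]
      exact heqO.map r
    have heqk : (((integralModelInt W).map (algebraMap ℤ O)).map (IsLocalRing.residue O)).toAffine.Equation c₀ d₀ :=
      (Affine.map_equation _ (algebraMap F kbar).injective c₀ d₀).mp heqkbar
    have hns₀ : (((integralModelInt W).map (algebraMap ℤ O)).map (IsLocalRing.residue O)).toAffine.Nonsingular c₀ d₀ :=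
      (Affine.equation_iff_nonsingular).mp heqk
    refine ⟨Affine.Point.some c₀ d₀ hns₀, ?_⟩
    obtain ⟨hy', hns2, e2⟩ := reducePoint_congrEquiv_some_of_val_le_one hΔu
      (localIntModel_baseChange W w.valuationSubring) x y h hx
    rw [hred₀, e2]
    change some (algebraMap F kbar c₀, algebraMap F kbar d₀) =
      some (rt (IsLocalRing.residue ↥w.valuationSubring ⟨x, hx⟩), rt (IsLocalRing.residue ↥w.valuationSubring ⟨y, hy'⟩))
    rw [hrt, hrt, hc₀, hd₀]
    rfl
  -- (⊇) every `𝔽_v`-point lifts to `E(ℚ_v) ⊆ M` (Hensel)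
  have hsup : ∀ Q, ∃ b : R, σB (b : _) = σF Q := by
    rintro (_ | ⟨c₀, d₀, hns₀⟩)
    · exact ⟨0, rfl⟩
    haveI : HenselianLocalRing O := inferInstance
    obtain ⟨a, b, hab, hac, hbd⟩ :=
      ((integralModelInt W).map (algebraMap ℤ O)).exists_equation_residue_eq hns₀
    let ι : O →+* L := (algebraMap K L).comp (algebraMap O K)
    have hιZ : ι.comp (algebraMap ℤ O) = (algebraMap ↥w.valuationSubring L).comp (algebraMap ℤ ↥w.valuationSubring) :=
      RingHom.ext_int _ _
    have habK : (W.baseChange L).toAffine.Equation (algebraMap K L (algebraMap O K a)) (algebraMap K L (algebraMap O K b)) := by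
      rw [← localIntModel_baseChange W w.valuationSubring, baseChange, WeierstrassCurve.map_map, ← hιZ,
        ← WeierstrassCurve.map_map]
      exact hab.map ι
    have hnsK : (W.baseChange L).toAffine.Nonsingular (algebraMap K L (algebraMap O K a)) (algebraMap K L (algebraMap O K b)) :=
      (Affine.equation_iff_nonsingular).mp habK
    obtain ⟨P₀, hP₀fix, hP₀eq⟩ : ∃ P₀ : localPoints W K, (∀ σ : absoluteGaloisGroup K, σ • P₀ = P₀) ∧
        P₀ = Affine.Point.some _ _ hnsK := by
      refine ⟨Affine.Point.some _ _ hnsK, fun σ ↦ ?_, rfl⟩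
      rw [localPoints.smul_def, Affine.Point.map_some]
      congr 1
      · exact σ.commutes (algebraMap O K a)
      · exact σ.commutes (algebraMap O K b)
    have hP₀M : P₀ ∈ M := (FixedPoints.mem_addSubgroup _ _ _).mpr fun σ ↦ hP₀fix σ
    refine ⟨⟨red₀ P₀, ⟨⟨P₀, hP₀M⟩, rfl⟩⟩, ?_⟩
    have hint1 : ∀ c : O, w (algebraMap K L (algebraMap O K c)) ≤ 1 := fun c ↦ by
      have h1 : (w (algebraMap K L (algebraMap O K c)) : ℝ) = ‖algebraMap O K c‖ := by
        rw [hw]; exact spectralNorm_extends _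
      have h2 : ‖algebraMap O K c‖ ≤ 1 := (Valued.toNormedField.norm_le_one_iff).mpr c.2
      rw [← NNReal.coe_le_coe, h1, NNReal.coe_one]; exact h2
    obtain ⟨hb1, hns1, e1⟩ := reducePoint_congrEquiv_some_of_val_le_one hΔu
      (localIntModel_baseChange W w.valuationSubring) _ _ hnsK (hint1 a)
    change σB (red₀ P₀) = _
    rw [hP₀eq, hred₀, e1]
    change some (rt (IsLocalRing.residue ↥w.valuationSubring _), rt (IsLocalRing.residue ↥w.valuationSubring _)) =
      some (algebraMap F kbar c₀, algebraMap F kbar d₀)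
    rw [hrt, hrt]
    simp only [Option.some.injEq, Prod.mk.injEq]
    exact ⟨(hrc a (hint1 a)).trans (by rw [hac]), (hrc b (hint1 b)).trans (by rw [hbd])⟩
  -- counting: both signatures are injective with the same image
  have himage : Set.range (fun b : R ↦ σB (b : _)) = Set.range σF := by
    ext s
    constructor
    · rintro ⟨b, rfl⟩
      obtain ⟨Q, hQ⟩ := hsub b
      exact ⟨Q, hQ⟩
    · rintro ⟨Q, rfl⟩
      obtain ⟨b, hb⟩ := hsup Q
      exact ⟨b, hb⟩
  have hinjR : Function.Injective (fun b : R ↦ σB (b : _)) := fun a b hab ↦ Subtype.ext (hσB hab)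
  have e1 : Nat.card R = Nat.card (Set.range (fun b : R ↦ σB (b : _))) :=
    (Nat.card_range_of_injective hinjR).symm
  have e2 : Nat.card (Set.range σF) =
      Nat.card (((integralModelInt W).map (algebraMap ℤ O)).map (IsLocalRing.residue O)).toAffine.Point :=
    Nat.card_range_of_injective hσF
  haveI hfinR : Finite R := by
    refine Nat.finite_of_card_ne_zero ?_
    rw [e1, himage, e2]
    exact Nat.card_pos.ne'
  refine ⟨hfinR, ?_⟩
  change Nat.card R = _
  rw [e1, himage, e2, natCard_point_integralModelInt_residue W hpv]

end Summit.BirchSwinnertonDyer.BirchSwinnertonDyer.Theorems.GoodOrdTower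

end
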